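import Literature.IUT.HodgeArakelov.Rmk111StructuresGenuine
import Literature.IUT.HodgeArakelov.FlSymmetryNonVacuity
import Literature.IUT.HodgeArakelov.Prop13ToyModel
import Literature.IUT.HodgeArakelov.CoreTowerNonVacuity
import Literature.IUT.HodgeArakelov.MonoThetaProjectiveNaturalSystemAtModelTate
import Literature.AnabelianGeometry.EtaleTheta.SettingModelTateMuTwoCLevel
import HarnessLib

/-!
# [IUTchII] Rmk. 1.1.1 (i)/(iii): the universal closures of `Rmk111_structures` (F-0671) and
# `rigidity_is_difference` (F-0672) DECIDED, and what the two typed predicates pin (proof-only)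

S. Mochizuki, *Inter-universal Teichmüller theory II*, §1, Remark 1.1.1 (i)–(iv), kurims manuscript (Dec. 2020) pp. 21–24
[claim: Mochizuki2012, status: disputed] (IUTchII §1 Rmk 1.1.1, kurims pp.21-24): (iii) p. 23 «The mono-theta-theoretic
cyclotomic rigidity isomorphism of Definition 1.1, (ii), is then reconstructed [cf. [EtTh], Corollary 2.19, (i)] by forming
the difference of the two sections `s^Θ(M^Θ)|_{(l·Δ_Θ)}`, `s^alg(M^Θ)|_{(l·Δ_Θ)}`»; [EtTh] Cor. 2.19 (i) p. 64
[cite: MochizukiEtTh2009, Cor 2.19(i) p.64]. abc-iut cell, seat abc-iut-f-127 (gen 6), L-F register row **LF6-40**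
(abc-iut-L6-lead g8 ROWS #4; director-abc g4 ROWS-LF-0348 rows 17–18): FACT-LIST rows **F-0671** `Rmk111_structures` and
**F-0672** `rigidity_is_difference` (abc-iut-L6-t1, `MonoThetaSymmetries.lean` p405595, FROZEN; tagged «[EtTh] Rmk1.1.1» in
the list — a tag erratum, the items are [IUTchII] §1 Rmk. 1.1.1 (i)/(iii)). PROOF-ONLY companion: no `def`, no `structure`,
no `instance`, nothing re-typed; every input consumed BY NAME.

§1 OVER THE INTERFACE (every `S`, `M`, `R`, `T`, `W`; no model):
* `CyclotomicRigidity.iso_eq_of_rigidity_is_difference` — (iii) PINS the Def. 1.1 (ii) datum: for a fixed two-sections datum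
  `Sec`, `rigidity_is_difference Sec C` determines `C.iso`.
* `TwoSections.exists_rigidity_is_difference_of_abelian` — but for EVERY `C` a two-sections datum differing from `Sec` in its
  theta section ALONE (`s^Θ := ` graph of `a ↦ s^alg(a)·C.iso[a]`; needs only `Π_M|_{(l·Δ_Θ)(M)}` abelian, a clause of every
  `FlSymmetry`) satisfies (iii) for `C`; hence `rmk111_structures_of_nonempty_flSymmetry`, **`rmk111_structures_indep`**
  (`Rmk111_structures R C ↔ Rmk111_structures R C′` for ALL `C, C′`) and `rmk111_structures_iff_exists_flSymmetry`: the typed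
  Rmk. 1.1.1 (i) predicate is the bare inhabitation of its parameter records `ThetaQuotientData` / `CoreTower` /
  `TwoSections` / `FlSymmetry` — its existential over two-sections data ABSORBS the (iii)-clause (INFO for the node registry,
  in the spirit of abc-iut-w5-d219's «action data idle» note on (iv): a faithful (i) would pin `s^Θ` to the image of the
  theta section portion of `M`, cf. the pins (P1)/(P2) of abc-iut-w4-d043's `exists_twoSections_rigidity_of_coreTower`).
§2 F-0671 CLOSURE REFUTED (schema): at abc-iut-f-185's closed toy Def. 1.1 output `Prop13Toy.recon` (`Π_Y = Π_X = Ẑ`,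
  junk by design) `(l·ℤ)(M)` is a point, so no `TwoSections` exists (`Prop13Toy.isEmpty_twoSections`) and
  `Rmk111_structures` fails for every Def. 1.1 (ii) datum — `not_forall_rmk111_structures`.
§3 F-0672 AT THE GENUINE [EtTh] FRAME (binders BY NAME = abc-iut-w5-d225's + `cl`): `Reconstruction.exists_extCyc_mul_self_ne_one`
  (`Π_μ ≅ ℤ/N` is not `2`-torsion once `N ∤ 2`); `ModelFrame.exists_twoSections_rigidity_decided_of_cLevelData` — for the
  pinned GENUINE sections, abc-iut-w4-d043's difference-convention datum `C′` satisfies (iii) and B8's datum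
  `F.cyclotomicRigidity e` (abc-iut-L2-t2's convention `s^alg·(s^Θ)⁻¹`) does NOT, by the convention theorem
  `rigidity_is_difference_iff_forall_mul_self_eq_one`; `ModelFrame.rmk111_structures_genuine_all` — F-0671 there for EVERY `C₀`.
§4 CLOSED (no `Prop` binder; `p` prime with `12 ∣ p − 1`, instance `p = 13`): `ModelTateCarriers.exists_rigidity_decided_modelTate_three`
  at level `N = 3` of the natural system of model mono-theta environments of the Tate curve over abc-iut-w5-d249's
  `MuTwoSetting.modelχq p 1 2` (every binder a theorem of record: `modelχq_cLevelData`, `modelχq_isEtThOrigin`, `hYcl_modelχq`,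
  (R1c) `toZ_conjX_epsPM_modelχq`, `modelχq_compat`, `modelχq_sec2Hyps`, `prop15iii_etaleThetaDataOfClass_etaDdχq`,
  `rootLift_mem_rootCocycles`, `nonempty_lDeltaQuot_rigidData_mulEquiv_zHat`; the cyclotome family from
  `modelχq_exists_cyclotomeMod_family`) ⇒ **`not_forall_rigidity_is_difference`** (F-0672 closure REFUTED at a GENUINE
  two-sections datum; the same datum carries F-0671 for every `C₀`).

FACT-LIST currency: F-0671 and F-0672 → «universal closure REFUTED / schema; instance forms are the content» — instance forms
BY NAME: `ModelFrame.exists_twoSections_rigidity_of_coreTower` (w4-d043, (iii) for `C′`), `exists_rmk111_structures_of_coreTower`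
/ `_genuine` / `exists_def11Output_rmk111_structures_genuine` (w4-d043), `exists_rmk111_allClauses_genuine` (w4-d035), this
file's `rmk111_structures_genuine_all` / §4. HONEST FRAMING: a refuted universal closure and a `C`-independence are statements
about OUR typing (junk data admitted by the interface; the (i)-record does not pin `s^Θ`), not findings against print, which
fixes no order of the «difference»; Rmk. 1.1.1 lies OUTSIDE the [IUTchIII] Cor. 3.12 cone; the claim key `Mochizuki2012` is
DISPUTED (D-0012) and nothing of it is asserted; no side is taken on Cor. 3.12; typed ≠ proved; instantiated ≠ endorsed;
nothing here asserts abc proved or refuted.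
-/

noncomputable section

namespace Literature.IUT.HodgeArakelov

universe u

/-! ## §1. Over abc-iut-L6-t1's interface: what (iii) pins and what (i) does not -/

section Abstract

variable {S : ThetaSetting.{u}} {M : MonoThetaEnv S} {R : Reconstruction M} {T : ThetaQuotientData R} {W : CoreTower R}

/-- **(iii) PINS the Def. 1.1 (ii) datum.** For a fixed two-sections datum `Sec`, two cyclotomic rigidity data that are
both «the difference of the two sections» have the same isomorphism: `rigidity_is_difference Sec C` determines `C.iso`
(the lifts `t ∈ s^Θ`, `s ∈ s^alg` over `a` are unique and `Π_μ(M) ↪ Π_M|_{(l·Δ_Θ)(M)}` is injective,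
`Π_μ(M) ∩ s^Θ|_{Ker} = 1`). [claim: Mochizuki2012, status: disputed] (IUTchII §1 Rmk 1.1.1 (iii), kurims p.23) -/
theorem CyclotomicRigidity.iso_eq_of_rigidity_is_difference (Sec : TwoSections T W) {C C' : CyclotomicRigidity R}
    (hC : rigidity_is_difference Sec C) (hC' : rigidity_is_difference Sec C') : C.iso = C'.iso := by
  refine MulEquiv.ext fun c => ?_
  obtain ⟨a, rfl⟩ := QuotientGroup.mk_surjective c
  obtain ⟨t, ht, hta⟩ := Sec.sTheta_bijOn.2.2 (Set.mem_univ a)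
  obtain ⟨s, hs, hsa⟩ := Sec.sAlg_bijOn.2.2 (Set.mem_univ a)
  obtain ⟨m₁, hm₁, h₁⟩ := hC a t s ht hs hta hsa
  obtain ⟨m₂, hm₂, h₂⟩ := hC' a t s ht hs hta hsa
  rw [hm₁, hm₂]
  have hcl := h₁.trans h₂.symm
  rw [QuotientGroup.eq, Subgroup.mem_subgroupOf] at hcl
  have hmem : ((m₁ : M.Pi))⁻¹ * (m₂ : M.Pi) ∈ R.extCyc ⊓ T.thetaSection :=
    Subgroup.mem_inf.2 ⟨mul_mem (inv_mem m₁.2) m₂.2, hcl⟩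
  rw [Sec.extCyc_inf_bot, Subgroup.mem_bot, inv_mul_eq_one] at hmem
  exact Subtype.ext hmem

/-- `Π_μ(M) ⊆ Π_M` lies in the `(l·Δ_Θ)`-preimage `Π_M|_{(l·Δ_Θ)(M)}` (it maps to `1 ∈ (l·Δ_Θ)(M)`).
[claim: Mochizuki2012, status: disputed] (IUTchII §1 Rmk 1.1.1 (iii), kurims p.22) -/
theorem ThetaQuotientData.extCyc_le_envAtTheta_top (T : ThetaQuotientData R) : R.extCyc ≤ T.envAtTheta.top := by
  intro m hm
  change m ∈ R.intCyc.top.comap R.projY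
  rw [Subgroup.mem_comap, (MonoidHom.mem_ker).1 hm]
  exact one_mem _

/-- **(i) does NOT pin the Def. 1.1 (ii) datum: re-twisting the theta section.** If `Π_M|_{(l·Δ_Θ)(M)}` is abelian (a
clause of every `FlSymmetry`), then for EVERY `C : CyclotomicRigidity R` the two-sections datum `Sec` can be modified in
its theta section ALONE (`s^Θ := ` the graph of `a ↦ s^alg(a) · C.iso[a]`; algebraic section, commutator map and all other
fields unchanged) so that `rigidity_is_difference` holds for `C`. [claim: Mochizuki2012, status: disputed] (IUTchII §1 Rmk 1.1.1 (iii), kurims p.23) -/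
theorem TwoSections.exists_rigidity_is_difference_of_abelian (Sec : TwoSections T W)
    (hab : ∀ x y : T.envAtTheta.carrier, x * y = y * x) (C : CyclotomicRigidity R) :
    ∃ Sec' : TwoSections T W, Sec'.sAlg = Sec.sAlg ∧ Sec'.commutator = Sec.commutator ∧
      rigidity_is_difference Sec' C := by
  classical
  -- the algebraic section as a homomorphism `σ : (l·Δ_Θ)(M) → Π_M|_{(l·Δ_Θ)(M)}`
  have hsurj := Sec.sAlg_bijOn.2.2
  have hinj := Sec.sAlg_bijOn.2.1
  choose σf hσmem hσproj using fun a : R.intCyc.carrier => hsurj (Set.mem_univ a)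
  have σ_mul : ∀ a b, σf (a * b) = σf a * σf b := fun a b =>
    hinj (hσmem _) (Sec.sAlg.mul_mem (hσmem a) (hσmem b)) (by rw [map_mul, hσproj, hσproj, hσproj])
  -- `Π_μ(M) → Π_M|_{(l·Δ_Θ)(M)}`, `m ↦ [m]`
  let ιh : ↥R.extCyc →* T.envAtTheta.carrier :=
    (QuotientGroup.mk' (T.envAtTheta.bot.subgroupOf T.envAtTheta.top)).comp
      (Subgroup.inclusion T.extCyc_le_envAtTheta_top)
  have hι_proj : ∀ m : ↥R.extCyc, T.proj (ιh m) = 1 := fun m => by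
    change T.proj (QuotientGroup.mk (Subgroup.inclusion T.extCyc_le_envAtTheta_top m)) = 1
    rw [ThetaQuotientData.proj, QuotientGroup.map_mk]
    have h1 : ((R.projY.restrict T.envAtTheta.top).codRestrict R.intCyc.top (fun x => x.2))
        (Subgroup.inclusion T.extCyc_le_envAtTheta_top m) = 1 :=
      Subtype.ext ((MonoidHom.mem_ker).1 m.2)
    rw [h1]
    rfl
  -- the Def. 1.1 (ii) datum read on `(l·Δ_Θ)(M)`: `a ↦ C.iso [a]`
  let κ : R.intCyc.carrier →* ↥R.extCyc :=
    C.iso.toMonoidHom.comp (QuotientGroup.mk' (Subgroup.normalClosure (Set.range fun a : R.intCyc.carrier =>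
      a ^ (S.N : ℕ))))
  have hκ : ∀ a, κ a = C.iso (QuotientGroup.mk a) := fun a => rfl
  -- the re-twisted theta section `a ↦ σ(a) · [C.iso [a]]`
  let φf : R.intCyc.carrier → T.envAtTheta.carrier := fun a => σf a * ιh (κ a)
  have φ_mul : ∀ a b, φf (a * b) = φf a * φf b := fun a b => by
    simp only [φf, σ_mul, map_mul]
    rw [mul_assoc, mul_assoc, ← mul_assoc (σf b), hab (σf b) (ιh (κ a)), mul_assoc]
  let φ : R.intCyc.carrier →* T.envAtTheta.carrier := MonoidHom.mk' φf φ_mul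
  have hφ_proj : ∀ a, T.proj (φ a) = a := fun a => by
    change T.proj (σf a * ιh (κ a)) = a
    rw [map_mul, hσproj, hι_proj, mul_one]
  have hbij : Set.BijOn T.proj (φ.range : Set T.envAtTheta.carrier) Set.univ := by
    refine ⟨Set.mapsTo_univ _ _, ?_, ?_⟩
    · rintro x ⟨a, rfl⟩ y ⟨b, rfl⟩ hxy
      rw [hφ_proj, hφ_proj] at hxy
      rw [hxy]
    · intro a _
      exact ⟨φ a, ⟨a, rfl⟩, hφ_proj a⟩
  refine ⟨{ Sec with sTheta := φ.range, sTheta_bijOn := hbij }, rfl, rfl, ?_⟩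
  intro a t s ht hs hta hsa
  obtain ⟨a', rfl⟩ := ht
  have ha' : a' = a := by rw [← hta, hφ_proj]
  subst ha'
  have hs' : s = σf a' := hinj hs (hσmem a') (by rw [hsa, hσproj])
  subst hs'
  refine ⟨C.iso (QuotientGroup.mk a'), rfl, ?_⟩
  change ιh (κ a') = σf a' * ιh (κ a') * (σf a')⁻¹
  rw [hab (σf a') (ιh (κ a')), mul_inv_cancel_right]

/-- **The typed Rmk. 1.1.1 (i) predicate holds for EVERY Def. 1.1 (ii) datum as soon as its parameter records are
inhabited**: if some two-sections datum `Sec` over `(R, T, W)` carries an `FlSymmetry`, then `Rmk111_structures R C` for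
ALL `C : CyclotomicRigidity R`. [claim: Mochizuki2012, status: disputed] (IUTchII §1 Rmk 1.1.1, kurims pp.21-24) -/
theorem rmk111_structures_of_nonempty_flSymmetry (Sec : TwoSections T W) (hF : Nonempty (FlSymmetry Sec))
    (C : CyclotomicRigidity R) : Rmk111_structures R C := by
  obtain ⟨Φ⟩ := hF
  obtain ⟨Sec', -, -, hrig⟩ := Sec.exists_rigidity_is_difference_of_abelian Φ.abelian C
  exact ⟨T, W, Sec', hrig, (FlSymmetry.nonempty_iff Sec').2 ((FlSymmetry.nonempty_iff Sec).1 ⟨Φ⟩)⟩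

omit T W in
/-- **`Rmk111_structures R C` is INDEPENDENT of `C`**: the existential over two-sections data absorbs the (iii)-clause.
[claim: Mochizuki2012, status: disputed] (IUTchII §1 Rmk 1.1.1, kurims pp.21-24) -/
theorem rmk111_structures_indep (R : Reconstruction M) (C C' : CyclotomicRigidity R) :
    Rmk111_structures R C ↔ Rmk111_structures R C' := by
  constructor
  · rintro ⟨T, W, Sec, -, hF⟩
    exact rmk111_structures_of_nonempty_flSymmetry Sec hF C'
  · rintro ⟨T, W, Sec, -, hF⟩
    exact rmk111_structures_of_nonempty_flSymmetry Sec hF C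

omit T W in
/-- **`Rmk111_structures R C` REDUCED to the inhabitation of its parameter records**: it holds iff there are theta-quotient
data `T`, a core tower `W` and a two-sections datum `Sec : TwoSections T W` carrying an `FlSymmetry` — equivalently
(abc-iut-w5-d219's `FlSymmetry.nonempty_iff`) with `Π_M|_{(l·Δ_Θ)(M)}` abelian, `Δ_X(M) ⊴ Δ_C(M)` and
`Δ_C(M)/Δ_X(M) ≅ 𝔽_l^{⋊±}`; the Def. 1.1 (ii) datum `C` plays no role.
[claim: Mochizuki2012, status: disputed] (IUTchII §1 Rmk 1.1.1, kurims pp.21-24) -/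
theorem rmk111_structures_iff_exists_flSymmetry (R : Reconstruction M) (C : CyclotomicRigidity R) :
    Rmk111_structures R C ↔
      ∃ (T : ThetaQuotientData R) (W : CoreTower R) (Sec : TwoSections T W), Nonempty (FlSymmetry Sec) := by
  constructor
  · rintro ⟨T, W, Sec, -, hF⟩
    exact ⟨T, W, Sec, hF⟩
  · rintro ⟨T, W, Sec, hF⟩
    exact rmk111_structures_of_nonempty_flSymmetry Sec hF C

end Abstract

/-! ## §2. F-0671: the universal closure of `Rmk111_structures` REFUTED at abc-iut-f-185's closed toy output -/

namespace Prop13Toy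

/-- At the toy Def. 1.1 (i) output (`Π_Y := Π_X := Ẑ`, `inclY := id`) the quotient `(l·ℤ)(M) = Π_X(M)/Π_Y(M)` is a
point. [claim: Mochizuki2012, status: disputed] (IUTchII §1 Def 1.1 (i), kurims p.21) -/
theorem subsingleton_lZ : Subsingleton recon.lZ := by
  unfold Reconstruction.lZ
  refine ⟨fun a b => ?_⟩
  obtain ⟨x, rfl⟩ := QuotientGroup.mk_surjective a
  obtain ⟨y, rfl⟩ := QuotientGroup.mk_surjective b
  exact QuotientGroup.eq.2 ⟨x⁻¹ * y, rfl⟩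

/-- Hence NO two-sections datum exists over the toy output (a `TwoSections` records `(l·ℤ)(M) ≅ ℤ`).
[claim: Mochizuki2012, status: disputed] (IUTchII §1 Rmk 1.1.1 (iii), kurims p.22) -/
theorem isEmpty_twoSections (T : ThetaQuotientData recon) (W : CoreTower recon) : IsEmpty (TwoSections T W) := by
  refine ⟨fun Sec => ?_⟩
  obtain ⟨e⟩ := Sec.lZ_iso
  haveI := subsingleton_lZ
  have h : e.symm (Multiplicative.ofAdd (1 : ℤ)) = e.symm 1 := Subsingleton.elim _ _
  have h' := e.symm.injective h
  exact absurd (Multiplicative.ofAdd.injective (h'.trans (ofAdd_zero).symm)) one_ne_zero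

/-- **F-0671 at the toy: `Rmk111_structures` FAILS** for the toy Def. 1.1 (i)/(ii) output (indeed for every Def. 1.1 (ii)
datum over the toy (i)-output). [claim: Mochizuki2012, status: disputed] (IUTchII §1 Rmk 1.1.1, kurims pp.21-24) -/
theorem not_rmk111_structures (C : CyclotomicRigidity recon) : ¬ Rmk111_structures recon C := by
  rintro ⟨T, W, Sec, -, -⟩
  exact (isEmpty_twoSections T W).false Sec

end Prop13Toy

/-- **F-0671 — the universal closure of the frozen `Rmk111_structures` is REFUTED** (schema): it fails at abc-iut-f-185's
closed toy Def. 1.1 output `Prop13Toy.recon` / `Prop13Toy.rigidity` (junk by design: `Π_Y = Π_X`, so `(l·ℤ)(M) = 1`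
admits no two-sections datum). [claim: Mochizuki2012, status: disputed] (IUTchII §1 Rmk 1.1.1, kurims pp.21-24) -/
theorem not_forall_rmk111_structures :
    ¬ ∀ (S : ThetaSetting.{0}) (M : MonoThetaEnv S) (R : Reconstruction M) (C : CyclotomicRigidity R),
        Rmk111_structures R C :=
  fun h => Prop13Toy.not_rmk111_structures Prop13Toy.rigidity (h _ _ _ _)

/-! ## §3. F-0672 at the GENUINE [EtTh] frame: the difference-convention datum satisfies (iii), B8's datum does NOT
once `N ∤ 2`; and F-0671 there for EVERY Def. 1.1 (ii) datum -/

namespace ModelFrame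

open Literature.AnabelianGeometry.EtaleTheta Literature.AnabelianGeometry.SemiGraphs
open scoped Literature.AnabelianGeometry.EtaleTheta

variable {p : ℕ} [Fact p.Prime] {Mt : MuTwoSetting p}
  {E : Mt.toThetaSetting.EtaleThetaData} {l : ℕ} (C : E.DoubleUnderline l)
  {S : ThetaSetting.{0}} (μ : Mt.toThetaSetting.CyclotomeMod l S.N)
  (hC : Mt.toThetaSetting.Compat) (hS : Mt.toThetaSetting.Sec2Hyps)
  (h15 : ThetaSetting.Prop15iii E hC) (L : C.CuspLabels)
  (F : ModelFrame S (C.rigidData μ hC hS h15 L)) {Menv : MonoThetaEnv S}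
  (e : Menv.Pi ≃ₜ* (C.rigidData μ hC hS h15 L).env)

/-- `Π_μ(M) ≅ (ℤ/Nℤ)(1)` is not `2`-torsion once `N ∤ 2` (Def. 1.1 (i): `ext_iso_ZMod`).
[claim: Mochizuki2012, status: disputed] (IUTchII §1 Def 1.1 (i), kurims p.21) -/
theorem _root_.Literature.IUT.HodgeArakelov.Reconstruction.exists_extCyc_mul_self_ne_one {S : ThetaSetting.{u}}
    {M : MonoThetaEnv S} (R : Reconstruction M) (hN : ¬ ((S.N : ℕ) ∣ 2)) :
    ∃ m : ↥R.extCyc, m * m ≠ 1 := by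
  obtain ⟨φ⟩ := R.ext_iso_ZMod
  refine ⟨φ.symm (Multiplicative.ofAdd 1), fun h => hN ?_⟩
  rw [← map_mul, ← ofAdd_add, MulEquiv.map_eq_one_iff, ofAdd_eq_one] at h
  have h2 : ((2 : ℕ) : ZMod (S.N : ℕ)) = 0 := by
    rw [Nat.cast_ofNat, ← one_add_one_eq_two]
    exact h
  exact (CharP.cast_eq_zero_iff (ZMod (S.N : ℕ)) (S.N : ℕ) 2).1 h2

/-- **F-0672 DECIDED BOTH WAYS at the genuine frame, level `N ∤ 2`.** Under the binders of abc-iut-w5-d225's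
`exists_twoSections_of_coreTower` plus a C-level datum `cl` (for the core tower, `CoreTowerNonVacuity`): there are a core
tower `W`, the model theta-quotient datum `T`, the pinned GENUINE two-sections datum `Sec` and the difference-convention
Def. 1.1 (ii) datum `C′` (`C′.iso = (B8 iso)⁻¹`) of abc-iut-w4-d043 with `rigidity_is_difference Sec C′` TRUE and
`rigidity_is_difference Sec (F.cyclotomicRigidity e)` FALSE (B8's datum = abc-iut-L2-t2's convention `s^alg · (s^Θ)⁻¹`):
by the convention theorem `rigidity_is_difference_iff_forall_mul_self_eq_one` both could hold only if `Π_μ(M) ≅ ℤ/N` were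
`2`-torsion. [claim: Mochizuki2012, status: disputed] (IUTchII §1 Rmk 1.1.1 (iii), kurims p.23) -/
theorem exists_twoSections_rigidity_decided_of_cLevelData (cl : Mt.CLevelData) (hO : Mt.toThetaSetting.IsEtThOrigin)
    (hYcl : (Mt.DtpY.map Mt.toHat.toMonoidHom).topologicalClosure ≤
      Mt.DtpY.map Mt.toHat.toMonoidHom ⊔ (⁅⁅Mt.DeltaHat, Mt.DeltaHat⁆, Mt.DeltaHat⁆).topologicalClosure)
    (hN : ¬ ((S.N : ℕ) ∣ 2)) :
    ∃ (W : CoreTower (F.reconstruction e)) (T : ThetaQuotientData (F.reconstruction e)) (Sec : TwoSections T W)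
      (C' : CyclotomicRigidity (F.reconstruction e)),
      (∀ c, ((C'.iso c : ↥(F.reconstruction e).extCyc) : Menv.Pi) =
        (((F.cyclotomicRigidity e).iso c : ↥(F.reconstruction e).extCyc) : Menv.Pi)⁻¹) ∧
      rigidity_is_difference Sec C' ∧ ¬ rigidity_is_difference Sec (F.cyclotomicRigidity e) := by
  obtain ⟨η, hη⟩ := (C.rigidData μ hC hS h15 L).thetaCocycles_nonempty
  obtain ⟨W, -, hWker⟩ := exists_coreTower_of_cLevelData C μ hC hS h15 L F e cl hO hYcl
  obtain ⟨T, Sec, C', -, hpin, hdiff, hiff⟩ :=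
    exists_twoSections_rigidity_convention_of_coreTower C μ hC hS h15 L F e hO hYcl hη W hWker
  obtain ⟨m, hm⟩ := (F.reconstruction e).exists_extCyc_mul_self_ne_one hN
  exact ⟨W, T, Sec, C', hpin, hdiff, fun h => hm (hiff.1 h m)⟩

/-- **F-0671 at the genuine frame for EVERY Def. 1.1 (ii) datum** (upgrade of abc-iut-w4-d043's
`exists_rmk111_structures_genuine`, which gives it for the difference-convention datum `C′`, by the `C`-independence
`rmk111_structures_indep`): under `cl`, `IsEtThOrigin`, `hYcl`, (R1c) `hR1c` and `hlS : S.l = l`, `Rmk111_structures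
(F.reconstruction e) C₀` for ALL `C₀` — in particular for B8's `F.cyclotomicRigidity e`, although THAT datum is NOT the
difference of the pinned genuine sections when `N ∤ 2` (previous theorem): the (i)-predicate re-twists `s^Θ`.
[claim: Mochizuki2012, status: disputed] (IUTchII §1 Rmk 1.1.1, kurims pp.21-24) -/
theorem rmk111_structures_genuine_all (cl : Mt.CLevelData) (hO : Mt.toThetaSetting.IsEtThOrigin)
    (hYcl : (Mt.DtpY.map Mt.toHat.toMonoidHom).topologicalClosure ≤
      Mt.DtpY.map Mt.toHat.toMonoidHom ⊔ (⁅⁅Mt.DeltaHat, Mt.DeltaHat⁆, Mt.DeltaHat⁆).topologicalClosure)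
    (hR1c : ∀ x : Mt.PiTemp, Mt.toZ (cl.conjX Mt.epsPM x) = (Mt.toZ x)⁻¹) (hlS : S.l = l)
    (C₀ : CyclotomicRigidity (F.reconstruction e)) : Rmk111_structures (F.reconstruction e) C₀ := by
  obtain ⟨η, hη⟩ := (C.rigidData μ hC hS h15 L).thetaCocycles_nonempty
  obtain ⟨W, T, Sec, C', -, -, -, -, hF, -⟩ :=
    exists_rmk111_structures_genuine C μ hC hS h15 L F e cl hO hYcl hR1c hlS hη
  exact rmk111_structures_of_nonempty_flSymmetry Sec hF C₀

end ModelFrame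

/-! ## §4. CLOSED certificates at the [EtTh] Tate model `MuTwoSetting.modelχq p 1 2` (`l = 3`, `12 ∣ p − 1`), level `N = 3` -/

namespace ModelTateCarriers

open Literature.AnabelianGeometry.EtaleTheta Literature.AnabelianGeometry.SemiGraphs
open Literature.AnabelianGeometry.EtaleTheta.SettingModel
open scoped Literature.AnabelianGeometry.EtaleTheta

/-- **F-0672 and F-0671 at ONE datum with NO `Prop` binder** (only the prime `p` with `12 ∣ p − 1`): at level `N = 3` of
the natural system of MODEL mono-theta environments of the Tate curve (abc-iut-w4-d030's `EtaleLevels.modelFrame`,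
identity frame; `l = 3`) over the [EtTh] stage-2 record `MuTwoSetting.modelχq p 1 2` (abc-iut-w5-d249) — C-level datum
`modelχq_cLevelData`, `IsEtThOrigin`, `hYcl`, (R1c) `toZ_conjX_epsPM_modelχq`, `Compat`, `Sec2Hyps`, `Prop15iii`
(`η̈^Θ := etaDdχq`, `inr`-section datum of abc-iut-L2-t6 / w5-d233), the root cocycle and `(l·Δ_Θ)/thetaKer ≅ Ẑ` ALL
theorems of record; the compatible cyclotome family is DATA, inhabited by abc-iut-L2-t8's `modelχq_exists_cyclotomeMod_family`
— there are `W, T`, a GENUINE two-sections datum `Sec` and Def. 1.1 (ii) data `C′` (difference convention) and `C` (B8's)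
with `rigidity_is_difference Sec C′`, `¬ rigidity_is_difference Sec C`, and `Rmk111_structures _ C₀` for EVERY `C₀`.
[claim: Mochizuki2012, status: disputed] (IUTchII §1 Rmk 1.1.1 (iii), kurims p.23) -/
theorem exists_rigidity_decided_modelTate_three (p : ℕ) [Fact p.Prime] (hdvd : 4 * ((3 : ℕ+) : ℕ) ∣ p - 1) :
    ∃ (S : ThetaSetting.{0}) (M : MonoThetaEnv S) (R : Reconstruction M) (W : CoreTower R) (T : ThetaQuotientData R)
      (Sec : TwoSections T W) (C' C : CyclotomicRigidity R),
      S.N = 3 ∧ rigidity_is_difference Sec C' ∧ ¬ rigidity_is_difference Sec C ∧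
        ∀ C₀ : CyclotomicRigidity R, Rmk111_structures R C₀ := by
  obtain ⟨mods, -⟩ := modelχq_exists_cyclotomeMod_family p 1 2 even_two (l := ((3 : ℕ+) : ℕ)) (by decide)
  have hodd : Odd ((3 : ℕ+) : ℕ) := by decide
  have hlp : ((3 : ℕ+) : ℕ).Prime := by decide
  -- the Def. 1.7 record and its [EtTh] §1/§2 data of record, typed over `Mt.toThetaSetting = ThetaSetting.modelχq p 1 2`
  let Mt : MuTwoSetting p := MuTwoSetting.modelχq p 1 2 even_two
  let hC : Mt.toThetaSetting.Compat := MuTwoSetting.modelχq_compat p 1 2 even_two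
  let hS : Mt.toThetaSetting.Sec2Hyps := ThetaSetting.modelχq_sec2Hyps p 1 2 even_two
  let K₀ := (kummerCoreχq p 1 2 even_two).toKummerDataOfSection SemidirectProduct.inr (continuous_inrχq p 1 2)
      (fun _ => rfl) (map_inr_GK_le_GtpY_modelχq' p 1 2 even_two) (map_inr_GKdd_le_GtpYdd_modelχq' p 1 2 even_two)
  let Euu : Mt.toThetaSetting.EtaleThetaData := K₀.etaleThetaDataOfClass (etaDdχq p 1 2 even_two)
  let Cuu : Euu.DoubleUnderline ((3 : ℕ+) : ℕ) :=
    (K₀.etaleThetaDataOfClass (etaDdχq p 1 2 even_two)).doubleUnderlineχqOfEtaRes p 1 2 3 hodd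
      (eta_res_etaDdχq p 1 2 even_two 3 hodd)
  let h15 : Literature.AnabelianGeometry.EtaleTheta.ThetaSetting.Prop15iii Euu hC :=
    prop15iii_etaleThetaDataOfClass_etaDdχq p hC SemidirectProduct.inr
      (continuous_inrχq p 1 2) (fun _ => rfl) (map_inr_GK_le_GtpY_modelχq' p 1 2 even_two)
      (map_inr_GKdd_le_GtpYdd_modelχq' p 1 2 even_two)
  let L : Cuu.CuspLabels := ⟨fun _ => ∅, fun _ => ∅, fun _ => rfl⟩
  let hO : Mt.toThetaSetting.IsEtThOrigin := MuTwoSetting.modelχq_isEtThOrigin p 1 2 even_two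
  have hYcl : (Mt.DtpY.map Mt.toHat.toMonoidHom).topologicalClosure ≤
      Mt.DtpY.map Mt.toHat.toMonoidHom ⊔ (⁅⁅Mt.DeltaHat, Mt.DeltaHat⁆, Mt.DeltaHat⁆).topologicalClosure :=
    hYcl_modelχq p 1 2 even_two
  let hp2 := ne_two_of_four_mul_dvd_pred p (3 : ℕ+).pos hdvd
  let hpl := ne_of_four_mul_dvd_pred p (3 : ℕ+).pos hdvd
  let hζ : ∃ ζ : Mt.K, IsPrimitiveRoot ζ (4 * ((3 : ℕ+) : ℕ)) :=
    exists_isPrimitiveRoot_K_modelχq p 1 2 even_two (3 : ℕ+).pos hdvd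
  let hZ : ∀ M : ℕ+, Nonempty (ModelCyclotomes.lDeltaQuot (Cuu.rigidData (mods M) hC hS h15 L) ≃*
      Literature.IUT.HodgeTheaters.ZHat) := fun M =>
    ModelCyclotomes.nonempty_lDeltaQuot_rigidData_mulEquiv_zHat Cuu (mods M) hC hS h15 L hO hYcl hlp.ne_zero
  let f := EtaleThetaDataOfSetting.rootLift Cuu
  let hf : f ∈ Cuu.rootCocycles hC := rootLift_mem_rootCocycles Cuu hC
  -- level `N = 3`: abc-iut-L6-d6's model frame at the identity, the model environment, the C-level datum
  let F := EtaleLevels.modelFrame Cuu hC hS hlp hp2 hpl hζ mods f hf h15 L hZ 3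
  let Menv : MonoThetaEnv (EtaleLevels.levelSetting Cuu hC hS hlp hp2 hpl hζ mods f hf 3) :=
    (EtaleLevels.modelFamily Cuu hC hS hlp hp2 hpl hζ mods f hf).modelEnv 3
  let e : Menv.Pi ≃ₜ* (Cuu.rigidData (mods 3) hC hS h15 L).env := ContinuousMulEquiv.refl _
  let cl : Mt.CLevelData := MuTwoSetting.modelχq_cLevelData p 1 2 even_two
  have hN : ¬ (((EtaleLevels.levelSetting Cuu hC hS hlp hp2 hpl hζ mods f hf 3).N : ℕ) ∣ 2) := by
    show ¬ (((3 : ℕ+) : ℕ) ∣ 2)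
    decide
  have h3 : (EtaleLevels.levelSetting Cuu hC hS hlp hp2 hpl hζ mods f hf 3).N = 3 := rfl
  have hl3 : (EtaleLevels.levelSetting Cuu hC hS hlp hp2 hpl hζ mods f hf 3).l = ((3 : ℕ+) : ℕ) := rfl
  have hR1c : ∀ x : Mt.PiTemp, Mt.toZ (cl.conjX Mt.epsPM x) = (Mt.toZ x)⁻¹ :=
    toZ_conjX_epsPM_modelχq p 1 2 even_two cl
  obtain ⟨W, T, Sec, C', -, hdiff, hnot⟩ :=
    ModelFrame.exists_twoSections_rigidity_decided_of_cLevelData Cuu (mods 3) hC hS h15 L F e cl hO hYcl hN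
  -- (no type ascription on `hall`: re-checking the two phrasings of the level setting is what costs heartbeats)
  have hall := ModelFrame.rmk111_structures_genuine_all Cuu (mods 3) hC hS h15 L F e cl hO hYcl hR1c hl3
  exact ⟨_, _, _, W, T, Sec, C', F.cyclotomicRigidity e, h3, hdiff, hnot, hall⟩

end ModelTateCarriers

/-- **F-0672 — the universal closure of the frozen `rigidity_is_difference` is REFUTED** (schema), at a GENUINE two-sections
datum: B8's own Def. 1.1 (ii) datum (convention `s^alg · (s^Θ)⁻¹`) over the level-`3` model mono-theta environment of the
Tate curve at `MuTwoSetting.modelχq 13 1 2` is NOT «`s^Θ · (s^alg)⁻¹`» of the pinned genuine sections (it is the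
inverse of that difference, and `Π_μ ≅ ℤ/3` is not `2`-torsion). The typed (iii)-clause pins `C.iso` given the sections
(`CyclotomicRigidity.iso_eq_of_rigidity_is_difference`), print fixes no order of the «difference»; the instance form of
record is abc-iut-w4-d043's `ModelFrame.exists_twoSections_rigidity_of_coreTower` (difference-convention datum `C′`).
[claim: Mochizuki2012, status: disputed] (IUTchII §1 Rmk 1.1.1 (iii), kurims p.23) -/
theorem not_forall_rigidity_is_difference :
    ¬ ∀ (S : ThetaSetting.{0}) (M : MonoThetaEnv S) (R : Reconstruction M) (T : ThetaQuotientData R)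
        (W : CoreTower R) (Sec : TwoSections T W) (C : CyclotomicRigidity R), rigidity_is_difference Sec C := by
  intro h
  haveI : Fact (Nat.Prime 13) := ⟨by norm_num⟩
  obtain ⟨S, M, R, W, T, Sec, -, C, -, -, hnot, -⟩ :=
    ModelTateCarriers.exists_rigidity_decided_modelTate_three 13 (by decide)
  exact hnot (h S M R T W Sec C)

end Literature.IUT.HodgeArakelov

end
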